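import Summits.HodgeConjecture.HodgeConjecture.Theorems.Ring2TransportWeilTypeGeneral
import Literature.AlgebraicGeometry.VanGeemen1994.WeilTypeHodgeRingOfSU
import HarnessLib

/-!
# Ring 2 · transport seat (gen 22) — row T6 with Weil's theorem DISCHARGED: the binder `VanGeemen1994_thm612` of gen 3's row-T6 theorems dropped, via the literature seat's PROVED corrected statement `VanGeemen1994_thm612_corrected_holds` (`n ≥ 2`) and the tree's unconditional `dim ≤ 3` theorem (`n = 1`)

HONEST FRAMING (cell `pub-hodge-ring2`, verbatim): research route conditional on HC_CM; not a corollary;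
Q11.4-sentence-2 already refuted in dim ≥ 3.

Seat `transport`, HOME `run/shared/lean/pub/pub-hodge-ring2/`, map `RING2-MAP.md §transport (gen 22)`; helper file
supporting `stmt-HodgeConjecture-16267` (`Theses.RankFourFaces.CMToAbelian`), count once. `HC_CM` is the tree item
`Theses.RankFourFaces.CMAbelianHodge` (stmt-HodgeConjecture-3052), ALWAYS an explicit binder, never a cited fact.

WHAT AND WHY. Gen 3 (`Ring2TransportWeilTypeGeneral.lean`) typed row T6 — the Hodge conjecture for the GENERAL abelian
variety of Weil type over an imaginary quadratic field (`HodgeGeneralWeilType`) — and proved `R∞ → T6`,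
`HC_CM → CMPointedWeilFamiliesQuadratic → (WeilVariationalHodgeQuadratic | LocalWeilVHCAtCMQuadratic) → T6` and the
`HC_CM`-free twins, each modulo the named fact `VanGeemen1994_thm612` (binder `h612`; van Geemen, LNM 1594, Thm. 6.12 =
Weil 1977: `Bᵖ ⊗ ℂ = Dᵖ ⊗ ℂ` for `p ≠ n`, `Bⁿ ⊗ ℂ = Dⁿ ⊗ ℂ ⊕ W_K ⊗ ℂ` when `Hg = SU_H`), typed over `0 < n`. The
literature seat (gen 18; `Literature/AlgebraicGeometry/VanGeemen1994/WeilTypeHodgeRingOfSU.lean`, p210207, commit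
631d91b5b1c6) (a) PROVED the statement on the carriers for every `n ≥ 2`,
`VanGeemen1994_thm612_corrected_holds : VanGeemen1994_thm612_corrected` (first fundamental theorem for `SL(W)` on
`⋀•(W ⊕ W^*)` by torus weights and signed transpositions), and (b) recorded that the `0 < n` typing is MISSTATED: at
`n = 1` (abelian surfaces of Weil type) the hypotheses are satisfiable on the intended models while the disjointness
conjunct fails (`D¹ ⊗ ℂ = B¹ ⊗ ℂ ⊇ W_K ⊗ ℂ ≠ 0`; van Geemen's Thm. 4.11 prints "(with `n > 1`)") — a finding of that
seat about the models, not a kernel refutation claimed here. Either way a theorem carrying `(h612 : VanGeemen1994_thm612)`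
says less than it appears to. Gen 3 USED `h612` only at `n ≥ 2` (its `n = 1` branch is the tree's unconditional
`hodgeConjectureFor_of_dim_le_three_holds`), so every row-T6 arrow holds with the binder DROPPED outright. This file
proves those binder-free forms (suffix `_discharged`; the gen-3 declarations stay in the tree untouched, as typed):

* §1 `hodgeConjectureFor_of_hasHodgeGroupSU_of_weilClasses_discharged` — the `(A, φ)`-slice: a Weil-type `(A, φ, n, d)`,
  `n, d ≥ 1`, with `Hg = SU_H` at a `K`-symmetrised hyperplane class and its OWN rational `(n,n)` Weil classes algebraic
  satisfies the Hodge conjecture — NO binder (`n ≥ 2`: 6.12 proved; `n = 1`: `dim A = 2 ≤ 3`); and the exactness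
  `hodgeConjectureFor_iff_weilClasses_of_hasHodgeGroupSU_discharged`.
* §2 `hodgeGeneralWeilType_of_weilClassesImaginaryQuadratic_discharged : WeilClassesImaginaryQuadratic → HodgeGeneralWeilType`
  (**R∞ ⟹ T6, unconditionally in the kernel**) and `hodgeGeneralWeilType_iff_generalWeilClasses_discharged`
  (T6 ⟺ R∞ on the general members).
* §3 the row-T6 theorems with THREE binders instead of four: `HC_GeneralWeilType_of_HC_CM_discharged :
  HC_CM → CMPointedWeilFamiliesQuadratic → WeilVariationalHodgeQuadratic → HodgeGeneralWeilType`, its LOCAL form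
  (`LocalWeilVHCAtCMQuadratic`), the `HC_CM`-free twins from gen 2's divisor-generated CM-pointed leaf, and the position
  statement `hodgeGeneralWeilType_position_discharged`.
* §0 `vanGeemen1994_thm612_corrected_of_thm612 : VanGeemen1994_thm612 → VanGeemen1994_thm612_corrected` (restriction
  `0 < n ↦ 2 ≤ n`): the gen-3 binder implies the proved statement, so each `_discharged` theorem is the gen-3 theorem
  with a hypothesis removed, never a different claim.

HONEST STATUS of T6 in print (unchanged by this file; see the cell paper, Remark `rem:T6-honest`): `n = 1` trivial;
`n = 2` over `ℚ(√-3)` and `ℚ(i)` for EVERY Weil fourfold of every discriminant class (Schoen 1988 Thm. 3.2 with the 1998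
Addendum, Theorem p. 329 and §10; Koike 2004 Cor. 2.1 / Rem. 2.1), discriminant `1` for every `K` (Markman 2023,
Thm. 1.5 = Thm. 13.4 as printed in JEMS 25; Thm. 1.3 of the pre-v4 arXiv text); `n = 3` over `ℚ(√-3)` general member with `det H = 1` (van Geemen 7.3; Schoen 1998 §§11–13) and over `ℚ(i)`
split (Koike Cor. 2.1); OPEN otherwise (the results of arXiv:2502.03415 are an unrefereed preprint). Nothing here is
summit progress: T6 is a CASE of the summit (`hodgeGeneralWeilType_of_hodgeConjecture`, gen 3).

References: B. van Geemen, *An introduction to the Hodge conjecture for abelian varieties*, LNM 1594 (1994), Thm. 4.11,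
Thm. 6.11–6.12, 2.4 [vanGeemen1994HodgeAV]; A. Weil, *Abelian varieties and the Hodge ring*, Œuvres III [1977c]
[Weil1977HodgeRing]; C. Schoen, Compositio Math. 65 (1988) 3–32 and Addendum, Compositio Math. 114 (1998) 329–336
[Schoen1988HodgeWeil, Schoen1998HodgeWeilAddendum]; K. Koike, *Algebraicity of some Weil Hodge classes*, Canad. Math.
Bull. 47 (2004) [Koike2004WeilHodge]; E. Markman, JEMS 25 (2023) 231–321, Thm. 1.5 (= Thm. 13.4), p. 236 [Markman2023GeneralizedKummers];
F. Charles, C. Schnell, *Notes on absolute Hodge classes* (2014), Conj. 11.3.1, Prop. 11.3.11 [CharlesSchnell2014Notes];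
R.-O. Buchweitz, H. Flenner, *A semiregularity map for modules and applications to deformations*, Compositio Math. 137
(2003), Thm. 5.1–5.2 [BuchweitzFlenner2003].
-/

set_option linter.dupNamespace false

noncomputable section

open CategoryTheory

namespace Summit.HodgeConjecture.HodgeConjecture.Ring2Transport

open Literature.AlgebraicGeometry Literature.AlgebraicGeometry.Motives
open Literature.AlgebraicGeometry.HodgeTheory
open Literature.AlgebraicTopology.SingularHomology
open Literature.AlgebraicGeometry.VanGeemen1994
open Literature.Barriers.HodgeConjecture (divisorClassesSpan)
open Summit.HodgeConjecture.HodgeConjecture.WeilTypeLadder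
open Summit.HodgeConjecture.HodgeConjecture.Theses

/-! ### §0 The gen-3 binder implies the proved corrected statement -/

/-- **`VanGeemen1994_thm612 → VanGeemen1994_thm612_corrected`**: the corrected statement (`2 ≤ n`) is the restriction of
the tree's `0 < n` named fact, so every `_discharged` theorem below is the corresponding gen-3 theorem with its `h612`
hypothesis removed. (The converse direction is exactly what the literature seat flags as misstated at `n = 1`.)
[cite: vanGeemen1994HodgeAV, Thm. 6.12 and Thm. 4.11 ("with n > 1")] -/
theorem vanGeemen1994_thm612_corrected_of_thm612 (h612 : VanGeemen1994_thm612) : VanGeemen1994_thm612_corrected :=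
  fun A φ n d e a hn hd hA hφ hW ha ha0 hSU ↦ h612 A φ n d e a (by omega) hd hA hφ hW ha ha0 hSU

/-! ### §1 The `(A, φ)`-slice, binder-free -/

/-- **The `(A, φ)`-slice of row T6, NO binder.** Let `(A, φ, n, d)` be of Weil type — `n, d ≥ 1`, `dim A = 2n`,
`φ ≫ φ = -d`, the Weil plane `weilClassesOf A φ n d` purely of Hodge type `(n,n)` (van Geemen 4.9) — with a
`K`-symmetrised hyperplane class `h = d·e^*a + φ^*e^*a` at which the special Mumford–Tate group is `SU_H`
(`HasHodgeGroupSU`, the general member, Thm. 6.11), and suppose the RATIONAL `(n,n)` classes of THIS Weil plane are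
algebraic. Then the Hodge conjecture holds for `A`. For `n ≥ 2`: Weil's theorem `Bᵖ ⊗ ℂ = Dᵖ ⊗ ℂ` (`p ≠ n`),
`Bⁿ ⊗ ℂ = Dⁿ ⊗ ℂ ⊔ W_K ⊗ ℂ`, now the tree THEOREM `VanGeemen1994_thm612_corrected_holds` (literature seat, gen 18), with
the divisor part algebraic by Lefschetz `(1,1)` + cup products (`divisorClassesSpan_le_algebraicClasses_dim`) and the Weil
part by `weilClassesOf_le_algebraicClasses_of_rational`; for `n = 1` (`dim A = 2`) the tree's unconditional
`hodgeConjectureFor_of_dim_le_three_holds`. Gen 3's `hodgeConjectureFor_of_hasHodgeGroupSU_of_weilClasses` is this with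
the extra binder `(h612 : VanGeemen1994_thm612)`.
[cite: vanGeemen1994HodgeAV, Thm. 4.11 (PDF p. 219), Thm. 6.11–6.12 (PDF pp. 231–232) and 2.4] [cite: Weil1977HodgeRing]
[cite: VoisinHodgeI2002, Thm. 11.30] -/
theorem hodgeConjectureFor_of_hasHodgeGroupSU_of_weilClasses_discharged
    {A : AbelianVariety ℂ} {φ : A ⟶ A} {n d : ℕ} (e : ProjectiveEmbedding A.X)
    {a : complexBetti (projectiveSpace e.n ℂ) 2} (hn : 0 < n) (hd : 0 < d) (hA : A.dim = 2 * n)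
    (hφ : φ ≫ φ = -(d • 𝟙 A))
    (hW : ∀ c ∈ weilClassesOf A φ n d, IsOfHodgeType (2 * n) A.X (2 * n) n n c)
    (ha : IsRationalClass a) (ha0 : a ≠ 0)
    (hSU : HasHodgeGroupSU A φ n d
      ((d : ℂ) • complexBetti.map e.ι 2 a + complexBetti.map φ.hom.hom.hom 2 (complexBetti.map e.ι 2 a)))
    (hR : ∀ c : complexBetti A.X (2 * n), IsRationalClass c → IsOfHodgeType (2 * n) A.X (2 * n) n n c →
      c ∈ weilClassesOf A φ n d → c ∈ algebraicClasses A.X n) :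
    HodgeConjectureFor A.dim A.X := by
  by_cases hn2 : 2 ≤ n
  · obtain ⟨-, -, hBD, hBn, -⟩ := VanGeemen1994_thm612_corrected_holds A φ n d e a hn2 hd hA hφ hW ha ha0 hSU
    have hWalg : weilClassesOf A φ n d ≤ algebraicClasses A.X n :=
      weilClassesOf_le_algebraicClasses_of_rational hn hd hA hφ hW hR
    refine ⟨nonempty_hodgeModel_holds (AbelianVariety.isSmoothProjective_holds (A := A)), fun p c hc hH ↦ ?_⟩
    have hcB : c ∈ hodgeClassSpan A.dim A.X p := Submodule.subset_span ⟨hc, hH⟩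
    by_cases hp : p = n
    · subst hp
      rw [hBn] at hcB
      exact sup_le (divisorClassesSpan_le_algebraicClasses_dim A p) hWalg hcB
    · rw [hBD p hp] at hcB
      exact divisorClassesSpan_le_algebraicClasses_dim A p hcB
  · exact hodgeConjectureFor_of_dim_le_three_holds (n := A.dim) (by omega)
      (AbelianVariety.isSmoothProjective_holds (A := A))

/-- **Exactness on the slice, NO binder**: for the general member, the Hodge conjecture for `A` is EQUIVALENT to the
algebraicity of `A`'s own rational `(n,n)` Weil classes (`→` trivial). Gen 3's
`hodgeConjectureFor_iff_weilClasses_of_hasHodgeGroupSU` without `h612`. [cite: vanGeemen1994HodgeAV, Thm. 4.11 and Thm. 6.12] -/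
theorem hodgeConjectureFor_iff_weilClasses_of_hasHodgeGroupSU_discharged
    {A : AbelianVariety ℂ} {φ : A ⟶ A} {n d : ℕ} (e : ProjectiveEmbedding A.X)
    {a : complexBetti (projectiveSpace e.n ℂ) 2} (hn : 0 < n) (hd : 0 < d) (hA : A.dim = 2 * n)
    (hφ : φ ≫ φ = -(d • 𝟙 A))
    (hW : ∀ c ∈ weilClassesOf A φ n d, IsOfHodgeType (2 * n) A.X (2 * n) n n c)
    (ha : IsRationalClass a) (ha0 : a ≠ 0)
    (hSU : HasHodgeGroupSU A φ n d
      ((d : ℂ) • complexBetti.map e.ι 2 a + complexBetti.map φ.hom.hom.hom 2 (complexBetti.map e.ι 2 a))) :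
    HodgeConjectureFor A.dim A.X ↔
      ∀ c : complexBetti A.X (2 * n), IsRationalClass c → IsOfHodgeType (2 * n) A.X (2 * n) n n c →
        c ∈ weilClassesOf A φ n d → c ∈ algebraicClasses A.X n := by
  refine ⟨fun hHC c hc hH _ ↦ ?_,
    fun hR ↦ hodgeConjectureFor_of_hasHodgeGroupSU_of_weilClasses_discharged e hn hd hA hφ hW ha ha0 hSU hR⟩
  have h2 := hHC.2 n c hc
  rw [hA] at h2
  exact h2 hH

/-! ### §2 R∞ ⟹ T6 with no binder -/

/-- **R∞ ⟹ T6, binder-free.** The imaginary-quadratic rung R∞ (`WeilTypeLadder.WeilClassesImaginaryQuadratic`: rational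
`(n,n)` Weil classes algebraic for every `n ≥ 2`, every `d`) gives the Hodge conjecture for every general Weil-type
`(A, φ, n, d)` — `n ≥ 2` by the binder-free slice theorem, `n = 1` by `dim ≤ 3`. NO `HC_CM`, no families, no named fact.
Gen 3's `hodgeGeneralWeilType_of_weilClassesImaginaryQuadratic` without `h612`.
[cite: vanGeemen1994HodgeAV, Thm. 4.11 and Thm. 6.12] [cite: VoisinHodgeII2003, §10.2.3 proof of Prop. 10.26] -/
theorem hodgeGeneralWeilType_of_weilClassesImaginaryQuadratic_discharged (hR : WeilClassesImaginaryQuadratic) :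
    HodgeGeneralWeilType := by
  intro A φ n d e a hn hd hA hφ hW ha ha0 hSU
  by_cases hn2 : 2 ≤ n
  · have hX : IsSmoothProjective (2 * n) A.X := by
      rw [← hA]; exact AbelianVariety.isSmoothProjective_holds (A := A)
    exact hodgeConjectureFor_of_hasHodgeGroupSU_of_weilClasses_discharged e hn hd hA hφ hW ha ha0 hSU
      fun c hc hH hcW ↦ hR n hn2 d hd A φ hA hX hφ c hc hH hcW
  · exact hodgeConjectureFor_of_dim_le_three_holds (n := A.dim) (by omega)
      (AbelianVariety.isSmoothProjective_holds (A := A))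

/-- **Exactness of row T6, binder-free: T6 ⟺ "R∞ on the general members".** Gen 3's
`hodgeGeneralWeilType_iff_generalWeilClasses` without `h612`. [cite: vanGeemen1994HodgeAV, Thm. 4.11 and Thm. 6.12] -/
theorem hodgeGeneralWeilType_iff_generalWeilClasses_discharged :
    HodgeGeneralWeilType ↔
      ∀ (A : AbelianVariety ℂ) (φ : A ⟶ A) (n d : ℕ) (e : ProjectiveEmbedding A.X)
        (a : complexBetti (projectiveSpace e.n ℂ) 2),
        0 < n → 0 < d → A.dim = 2 * n → φ ≫ φ = -(d • 𝟙 A) →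
        (∀ c ∈ weilClassesOf A φ n d, IsOfHodgeType (2 * n) A.X (2 * n) n n c) →
        IsRationalClass a → a ≠ 0 →
        HasHodgeGroupSU A φ n d
          ((d : ℂ) • complexBetti.map e.ι 2 a + complexBetti.map φ.hom.hom.hom 2 (complexBetti.map e.ι 2 a)) →
        ∀ c : complexBetti A.X (2 * n), IsRationalClass c → IsOfHodgeType (2 * n) A.X (2 * n) n n c →
          c ∈ weilClassesOf A φ n d → c ∈ algebraicClasses A.X n :=
  ⟨fun h A φ n d e a hn hd hA hφ hW ha ha0 hSU ↦
      (hodgeConjectureFor_iff_weilClasses_of_hasHodgeGroupSU_discharged e hn hd hA hφ hW ha ha0 hSU).1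
        (h A φ n d e a hn hd hA hφ hW ha ha0 hSU),
    fun h A φ n d e a hn hd hA hφ hW ha ha0 hSU ↦
      hodgeConjectureFor_of_hasHodgeGroupSU_of_weilClasses_discharged e hn hd hA hφ hW ha ha0 hSU
        (h A φ n d e a hn hd hA hφ hW ha ha0 hSU)⟩

/-! ### §3 Row T6 with three binders: `HC_CM`, the CM-pointed families leaf, one transport leaf -/

/-- **Row T6, global transport form, 6.12 discharged: `HC_CM → CMPointedWeilFamiliesQuadratic →
WeilVariationalHodgeQuadratic → HodgeGeneralWeilType`.** `HC_CM` makes the CM fibre of a CM-pointed Weil family an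
algebraic anchor, Weil-confined variational Hodge (R∞var; Grothendieck's footnote 13 / Charles–Schnell Conj. 11.3.1
restricted to Weil classes) transports algebraicity to every member (gen 1, rung R∞), and Weil's theorem — now proved in
the tree for `n ≥ 2` — upgrades R∞ to the whole Hodge ring on the general members. CONDITIONAL on the three named
hypotheses; `HC_CM` is a binder, consumed only in gen 1's `mem_algebraicClasses_of_cmChart`.
[cite: vanGeemen1994HodgeAV, Thm. 4.11 and Thm. 6.12] [cite: CharlesSchnell2014Notes, Conj. 11.3.1 (p. 477)]
[cite: Deligne1982HodgeCycles, §4, proof of Thm. 4.8 (a)–(c)] -/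
theorem HC_GeneralWeilType_of_HC_CM_discharged (hCM : Theses.RankFourFaces.CMAbelianHodge)
    (hP : CMPointedWeilFamiliesQuadratic) (hV : WeilVariationalHodgeQuadratic) : HodgeGeneralWeilType :=
  hodgeGeneralWeilType_of_weilClassesImaginaryQuadratic_discharged (HC_WeilClassesQuadratic_of_HC_CM hCM hP hV)

/-- **Row T6, LOCAL form, 6.12 discharged: `HC_CM → CMPointedWeilFamiliesQuadratic → LocalWeilVHCAtCMQuadratic →
HodgeGeneralWeilType`.** The local leaf is the OUTPUT SHAPE of the strict semiregularity theorem (Bloch 1972;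
Buchweitz–Flenner 2003 Thm. 5.1/5.2) at a semiregular representative — NOT the weak criterion of Markman's Question 11.4
sentence 2 (refuted in dim ≥ 3, `HodgeTheory/SemiregularityWeakCriterionAbelianCounterexample`); Baire + Charles–Schnell
Prop. 11.3.11 spreads it over the base (gen 1). CONDITIONAL on the three named hypotheses.
[cite: BuchweitzFlenner2003, Thm. 5.1 and Thm. 5.2] [cite: CharlesSchnell2014Notes, Prop. 11.3.11]
[cite: vanGeemen1994HodgeAV, Thm. 6.12] -/
theorem HC_GeneralWeilType_of_HC_CM_local_discharged (hCM : Theses.RankFourFaces.CMAbelianHodge)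
    (hP : CMPointedWeilFamiliesQuadratic) (hL : LocalWeilVHCAtCMQuadratic) : HodgeGeneralWeilType :=
  hodgeGeneralWeilType_of_weilClassesImaginaryQuadratic_discharged (HC_WeilClassesQuadratic_of_HC_CM_local hCM hP hL)

/-- **Row T6 WITHOUT `HC_CM` and without 6.12 as a binder: `DivisorGeneratedCMPointedWeilFamiliesQuadratic →
LocalWeilVHCAtCMQuadratic → HodgeGeneralWeilType`** (load-bearing audit: on row T6 `HC_CM` is NOMINAL — every Weil
component over an imaginary quadratic field contains the diagonal CM member `E_Kⁿ × E_Kⁿ`, on which `Hdg = Div`; gen 2).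
[cite: vanGeemen1994HodgeAV, 2.4 and Thm. 6.12] [cite: Gordon1997, Thm. 6.4 and §3] -/
theorem HC_GeneralWeilType_of_divisorGeneratedCMPointed_discharged (hP : DivisorGeneratedCMPointedWeilFamiliesQuadratic)
    (hL : LocalWeilVHCAtCMQuadratic) : HodgeGeneralWeilType :=
  hodgeGeneralWeilType_of_weilClassesImaginaryQuadratic_discharged
    (HC_WeilClassesQuadratic_of_divisorGeneratedCMPointed_local hP hL)

/-- The same without `HC_CM`, global transport form (R∞var), 6.12 discharged. [cite: vanGeemen1994HodgeAV, Thm. 6.12]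
[cite: CharlesSchnell2014Notes, Conj. 11.3.1] -/
theorem HC_GeneralWeilType_of_divisorGeneratedCMPointed_of_variational_discharged
    (hP : DivisorGeneratedCMPointedWeilFamiliesQuadratic) (hV : WeilVariationalHodgeQuadratic) : HodgeGeneralWeilType :=
  hodgeGeneralWeilType_of_weilClassesImaginaryQuadratic_discharged
    (HC_WeilClassesQuadratic_of_divisorGeneratedCMPointed hP hV)

/-- **Where T6 sits, with no named fact left: `HC_AV ⟹ T6 ⟸ R∞`, and under `HC_CM` (resp. with a diagonal CM fibre)
the rung R∞ is its transport leaf** — the honest reading of row T6 is "`HC_CM` nominal; content = Weil-confined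
variational Hodge (R∞var, or the local germ at CM fibres)"; Weil 1977 / van Geemen 6.12 is a theorem of the tree for
`n ≥ 2`. Recorded as the conjunction of four kernel arrows. [cite: vanGeemen1994HodgeAV, Thm. 6.12]
[cite: Markman2025SurveySecant, §12 (preprint / ICM 2026 lecture, unrefereed)] -/
theorem hodgeGeneralWeilType_position_discharged :
    (PadicSemiregularLift.HodgeAbelianVarieties → HodgeGeneralWeilType) ∧
      (WeilClassesImaginaryQuadratic → HodgeGeneralWeilType) ∧
      (Theses.RankFourFaces.CMAbelianHodge → CMPointedWeilFamiliesQuadratic → LocalWeilVHCAtCMQuadratic →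
        HodgeGeneralWeilType) ∧
      (DivisorGeneratedCMPointedWeilFamiliesQuadratic → LocalWeilVHCAtCMQuadratic → HodgeGeneralWeilType) :=
  ⟨hodgeGeneralWeilType_of_hodgeAbelianVarieties, hodgeGeneralWeilType_of_weilClassesImaginaryQuadratic_discharged,
    HC_GeneralWeilType_of_HC_CM_local_discharged, HC_GeneralWeilType_of_divisorGeneratedCMPointed_discharged⟩

end Summit.HodgeConjecture.HodgeConjecture.Ring2Transport

end
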